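/-
Copyright (c) 2026. All rights reserved.
Released under Apache 2.0 license as described in the file LICENSE.
-/
import Literature.Geometry.Kaehler.ComplexTorusQuaternionXSixSpecialCyclesNormaliserClassCount
import Literature.Geometry.Kaehler.ComplexTorusQuaternionXSixSpecialCyclesPointCount
import HarnessLib

/-!
# Special cycles on `X₆` modulo Atkin–Lehner: the inequality chain
# `|L(t)/Γ₆|/8 ≤ |L(t)/N(O₆)| ≤ |L(t)/O₆^×| = |L(t)/Γ₆|/2` for every `t > 0`

[tag: complex_torus] [tag: abelian_surface] [tag: quaternion_multiplication] [tag: complex_multiplication]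
[tag: shimura_curve] [tag: special_cycles] [tag: atkin_lehner]

A two-theorem companion to `…XSixSpecialCyclesNormaliserClassCount` (which has reached the file-size ceiling): for
every `t > 0` the three class counts of the special vectors `L(t) = {x̂ = x₁i + x₂j + x₃ij : x₁² − 3x₂² − 3x₃² = t}` of
`O₆ ⊂ (−1,3)_ℚ` — modulo `Γ₆ = O₆¹`, modulo `O₆^×`, modulo the normaliser `N(O₆) = ℚ^×O₆^{±1}{1, w₂, μ, w₂μ}` — satisfy

* `card_normaliser_classes_le_card_unit_classes`: **`|L(t)/N(O₆)| ≤ |L(t)/O₆^×|`** (`O₆^×`-classes map onto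
  `N(O₆)`-classes);
* `card_normOne_classes_le_eight_mul_card_normaliser_classes`: **`|L(t)/Γ₆| ≤ 8·|L(t)/N(O₆)|` and
  `2·|L(t)/N(O₆)| ≤ |L(t)/Γ₆|`** — from `|L(t)/Γ₆| = 2·|L(t)/O₆^×|`
  (`card_normOne_classes_eq_two_mul_card_unit_classes`) and at most four sheets over `N(O₆)`
  (`card_unit_classes_le_four_mul_card_normaliser_classes`). The lower bound `|L(t)/Γ₆|/8` is attained exactly when
  `W ≅ (ℤ/2ℤ)²` acts freely (`t ≡ 19 (mod 24)`: `card_normOne_classes_eq_eight_mul_card_normaliser_classes`); at `t = 1`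
  (`4 ≤ 8·1`, `2·1 ≤ 4`) and `t = 25` (`12 ≤ 16`, `4 ≤ 12`) both inequalities are strict.
* §2, POINTS: `card_specialPoints_eq_four_mul_card_normaliser_classes` (**`#(Pt(t)/Γ₆) = 4·|L(t)/N(O₆)|`** for
  `t ≡ 19 (mod 24)`, with `#(Pt(t)/Γ₆) = |L(t)/O₆^×|` of `…XSixSpecialCyclesPointCount`),
  `card_specialPoints_le_four_mul_card_normaliser_classes` (every `t > 0`), `card_specialPoints_nineteen` (`Z(19)`: four
  points on `X₆`, one class up to Atkin–Lehner).

## The print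

* S. Kudla, M. Rapoport, T. Yang (2006), §3.4 (3.4.13) and Remark 3.4.7 («we consider only cycles which are invariant
  under the group of Atkin-Lehner involutions»). [cite: KudlaRapoportYang2006, §3.4 Remark 3.4.7]
* M.-F. Vignéras (1980), Ch. IV §3 B («`N(O)/O^×ℚ^× = (ℤ/2ℤ)^{2m}`»). [cite: VignerasLNM800, Ch. IV §3 B]

## Scope (honest)

Theorems only — no definitions, no named facts, no instances; the relations are the inline ones of the parent file.
-/

noncomputable section

set_option maxSynthPendingDepth 3

open Quaternion Function

namespace Literature.Geometry.Kaehler.ComplexTorus.QuaternionType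

section Chain

/-- **`|L(t)/N(O₆)| ≤ |L(t)/O₆^×|`** for every `t > 0`: `O₆^×`-classes map ONTO `N(O₆)`-classes. [cite: VignerasLNM800, Ch. IV §3 B] -/
theorem card_normaliser_classes_le_card_unit_classes {t : ℤ} (ht : 0 < t) :
    Nat.card (Quot (fun x y : {x : ℤ × ℤ × ℤ // x.1 ^ 2 - 3 * x.2.1 ^ 2 - 3 * x.2.2 ^ 2 = t} ↦
      ∃ g : ℍ[ℚ,((-1 : ℤ) : ℚ),((3 : ℤ) : ℚ)], g ≠ 0 ∧
        (∀ a : ℍ[ℚ,((-1 : ℤ) : ℚ),((3 : ℤ) : ℚ)], (a ∈ order (-1) 3 ∨ a - ⟨1/2, 1/2, 1/2, -1/2⟩ ∈ order (-1) 3) →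
          ∃ b : ℍ[ℚ,((-1 : ℤ) : ℚ),((3 : ℤ) : ℚ)], (b ∈ order (-1) 3 ∨ b - ⟨1/2, 1/2, 1/2, -1/2⟩ ∈ order (-1) 3) ∧
            g * a = b * g) ∧
        g * ⟨0, x.1.1, x.1.2.1, x.1.2.2⟩ = ⟨0, y.1.1, y.1.2.1, y.1.2.2⟩ * g)) ≤ Nat.card (Quot (fun x y : {x : ℤ × ℤ × ℤ // x.1 ^ 2 - 3 * x.2.1 ^ 2 - 3 * x.2.2 ^ 2 = t} ↦
      ∃ v : ℍ[ℚ,((-1 : ℤ) : ℚ),((3 : ℤ) : ℚ)], (v ∈ order (-1) 3 ∨ v - ⟨1/2, 1/2, 1/2, -1/2⟩ ∈ order (-1) 3) ∧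
        ((v * star v).re = 1 ∨ (v * star v).re = -1) ∧
        v * ⟨0, x.1.1, x.1.2.1, x.1.2.2⟩ = ⟨0, y.1.1, y.1.2.1, y.1.2.2⟩ * v)) := by
  set R : {x : ℤ × ℤ × ℤ // x.1 ^ 2 - 3 * x.2.1 ^ 2 - 3 * x.2.2 ^ 2 = t} →
      {x : ℤ × ℤ × ℤ // x.1 ^ 2 - 3 * x.2.1 ^ 2 - 3 * x.2.2 ^ 2 = t} → Prop :=
    fun x y ↦ ∃ v : ℍ[ℚ,((-1 : ℤ) : ℚ),((3 : ℤ) : ℚ)], (v ∈ order (-1) 3 ∨ v - ⟨1/2, 1/2, 1/2, -1/2⟩ ∈ order (-1) 3) ∧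
        ((v * star v).re = 1 ∨ (v * star v).re = -1) ∧
        v * ⟨0, x.1.1, x.1.2.1, x.1.2.2⟩ = ⟨0, y.1.1, y.1.2.1, y.1.2.2⟩ * v with hR
  set N : {x : ℤ × ℤ × ℤ // x.1 ^ 2 - 3 * x.2.1 ^ 2 - 3 * x.2.2 ^ 2 = t} →
      {x : ℤ × ℤ × ℤ // x.1 ^ 2 - 3 * x.2.1 ^ 2 - 3 * x.2.2 ^ 2 = t} → Prop :=
    fun x y ↦ ∃ g : ℍ[ℚ,((-1 : ℤ) : ℚ),((3 : ℤ) : ℚ)], g ≠ 0 ∧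
        (∀ a : ℍ[ℚ,((-1 : ℤ) : ℚ),((3 : ℤ) : ℚ)], (a ∈ order (-1) 3 ∨ a - ⟨1/2, 1/2, 1/2, -1/2⟩ ∈ order (-1) 3) →
          ∃ b : ℍ[ℚ,((-1 : ℤ) : ℚ),((3 : ℤ) : ℚ)], (b ∈ order (-1) 3 ∨ b - ⟨1/2, 1/2, 1/2, -1/2⟩ ∈ order (-1) 3) ∧
            g * a = b * g) ∧
        g * ⟨0, x.1.1, x.1.2.1, x.1.2.2⟩ = ⟨0, y.1.1, y.1.2.1, y.1.2.2⟩ * g with hN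
  haveI : Finite (Quot R) := finite_unit_classes ht
  have hiffN : ∀ x y, Quot.mk N x = Quot.mk N y ↔ N x y := normaliser_conj_mk_eq_iff t
  have hRN : ∀ x y, R x y → N x y := fun x y h ↦ (normaliser_conj_iff t x y).2 (Or.inl h)
  have hf : Function.Surjective
      (Quot.lift (fun x ↦ Quot.mk N x) fun x y h ↦ (hiffN x y).2 (hRN x y h) : Quot R → Quot N) := by
    intro q
    induction q using Quot.ind with
    | _ x => exact ⟨Quot.mk R x, rfl⟩
  exact Nat.card_le_card_of_surjective _ hf

/-- **THE CHAIN `|L(t)/Γ₆| ≤ 8·|L(t)/N(O₆)|` and `2·|L(t)/N(O₆)| ≤ |L(t)/Γ₆|`** for every `t > 0` (from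
`|L(t)/Γ₆| = 2·|L(t)/O₆^×|`, at most four sheets over `N(O₆)`, and the surjection); both bounds are attained
(`t = 19`: `8 = 8·1`; `t = 1`: `2·1 ≤ 4` is strict, `t = 25`: `2·2 ≤ 12`). [cite: KudlaRapoportYang2006, §3.4 (3.4.13) and Remark 3.4.7] [cite: VignerasLNM800, Ch. IV §3 B] -/
theorem card_normOne_classes_le_eight_mul_card_normaliser_classes {t : ℤ} (ht : 0 < t) :
    Nat.card (Quot (fun x y : {x : ℤ × ℤ × ℤ // x.1 ^ 2 - 3 * x.2.1 ^ 2 - 3 * x.2.2 ^ 2 = t} ↦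
      ∃ u : ℍ[ℚ,((-1 : ℤ) : ℚ),((3 : ℤ) : ℚ)], (u ∈ order (-1) 3 ∨ u - ⟨1/2, 1/2, 1/2, -1/2⟩ ∈ order (-1) 3) ∧
        (u * star u).re = 1 ∧ u * ⟨0, x.1.1, x.1.2.1, x.1.2.2⟩ = ⟨0, y.1.1, y.1.2.1, y.1.2.2⟩ * u)) ≤ 8 * Nat.card (Quot (fun x y : {x : ℤ × ℤ × ℤ // x.1 ^ 2 - 3 * x.2.1 ^ 2 - 3 * x.2.2 ^ 2 = t} ↦
      ∃ g : ℍ[ℚ,((-1 : ℤ) : ℚ),((3 : ℤ) : ℚ)], g ≠ 0 ∧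
        (∀ a : ℍ[ℚ,((-1 : ℤ) : ℚ),((3 : ℤ) : ℚ)], (a ∈ order (-1) 3 ∨ a - ⟨1/2, 1/2, 1/2, -1/2⟩ ∈ order (-1) 3) →
          ∃ b : ℍ[ℚ,((-1 : ℤ) : ℚ),((3 : ℤ) : ℚ)], (b ∈ order (-1) 3 ∨ b - ⟨1/2, 1/2, 1/2, -1/2⟩ ∈ order (-1) 3) ∧
            g * a = b * g) ∧
        g * ⟨0, x.1.1, x.1.2.1, x.1.2.2⟩ = ⟨0, y.1.1, y.1.2.1, y.1.2.2⟩ * g)) ∧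
    2 * Nat.card (Quot (fun x y : {x : ℤ × ℤ × ℤ // x.1 ^ 2 - 3 * x.2.1 ^ 2 - 3 * x.2.2 ^ 2 = t} ↦
      ∃ g : ℍ[ℚ,((-1 : ℤ) : ℚ),((3 : ℤ) : ℚ)], g ≠ 0 ∧
        (∀ a : ℍ[ℚ,((-1 : ℤ) : ℚ),((3 : ℤ) : ℚ)], (a ∈ order (-1) 3 ∨ a - ⟨1/2, 1/2, 1/2, -1/2⟩ ∈ order (-1) 3) →
          ∃ b : ℍ[ℚ,((-1 : ℤ) : ℚ),((3 : ℤ) : ℚ)], (b ∈ order (-1) 3 ∨ b - ⟨1/2, 1/2, 1/2, -1/2⟩ ∈ order (-1) 3) ∧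
            g * a = b * g) ∧
        g * ⟨0, x.1.1, x.1.2.1, x.1.2.2⟩ = ⟨0, y.1.1, y.1.2.1, y.1.2.2⟩ * g)) ≤ Nat.card (Quot (fun x y : {x : ℤ × ℤ × ℤ // x.1 ^ 2 - 3 * x.2.1 ^ 2 - 3 * x.2.2 ^ 2 = t} ↦
      ∃ u : ℍ[ℚ,((-1 : ℤ) : ℚ),((3 : ℤ) : ℚ)], (u ∈ order (-1) 3 ∨ u - ⟨1/2, 1/2, 1/2, -1/2⟩ ∈ order (-1) 3) ∧
        (u * star u).re = 1 ∧ u * ⟨0, x.1.1, x.1.2.1, x.1.2.2⟩ = ⟨0, y.1.1, y.1.2.1, y.1.2.2⟩ * u)) := by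
  have h1 := card_normOne_classes_eq_two_mul_card_unit_classes ht
  have h2 := card_unit_classes_le_four_mul_card_normaliser_classes ht
  have h3 := card_normaliser_classes_le_card_unit_classes ht
  constructor <;> omega

end Chain
/-! ## §2 Points of `Z(t)` on `X₆` against normaliser classes -/

/-- **`#(Pt(t)/Γ₆) = 4·|L(t)/N(O₆)|` for `t > 0`, `3 ∤ t`, `t ≡ 3 (mod 4)`**: the number of points of `X₆` below the
special cycle `Z(t)` (`card_specialPoints_eq_card_unit_classes` of `…XSixSpecialCyclesPointCount`: `= |L(t)/O₆^×|`) is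
four times the number of special vectors «up to Atkin–Lehner» (`card_unit_classes_eq_four_mul_card_normaliser_classes`)
— KRY's count of `W`-invariant components. [cite: KudlaRapoportYang2006, §3.4 (3.4.13) and Remark 3.4.7] [cite: VignerasLNM800, Ch. IV §3 B] -/
theorem card_specialPoints_eq_four_mul_card_normaliser_classes {t : ℤ} (ht : 0 < t) (h3 : ¬ (3 : ℤ) ∣ t)
    (h4 : t % 4 = 3) :
    Nat.card (Quot (fun p q : {τ : ℂ // 0 < τ.im ∧ ∃ x : ℍ[ℚ,((-1 : ℤ) : ℚ),((3 : ℤ) : ℚ)],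
        x ∈ order (-1) 3 ∧ x.re = 0 ∧ (x * star x).re = t ∧ moebius (rho (-1) 3 (by norm_num) (castQ (-1) 3 x)) τ = τ} ↦
      ∃ v : ℍ[ℚ,((-1 : ℤ) : ℚ),((3 : ℤ) : ℚ)], (v ∈ order (-1) 3 ∨ v - ⟨1/2, 1/2, 1/2, -1/2⟩ ∈ order (-1) 3) ∧
        v * star v = 1 ∧ moebius (rho (-1) 3 (by norm_num) (castQ (-1) 3 v)) p.1 = q.1)) = 4 * Nat.card (Quot (fun x y : {x : ℤ × ℤ × ℤ // x.1 ^ 2 - 3 * x.2.1 ^ 2 - 3 * x.2.2 ^ 2 = t} ↦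
      ∃ g : ℍ[ℚ,((-1 : ℤ) : ℚ),((3 : ℤ) : ℚ)], g ≠ 0 ∧
        (∀ a : ℍ[ℚ,((-1 : ℤ) : ℚ),((3 : ℤ) : ℚ)], (a ∈ order (-1) 3 ∨ a - ⟨1/2, 1/2, 1/2, -1/2⟩ ∈ order (-1) 3) →
          ∃ b : ℍ[ℚ,((-1 : ℤ) : ℚ),((3 : ℤ) : ℚ)], (b ∈ order (-1) 3 ∨ b - ⟨1/2, 1/2, 1/2, -1/2⟩ ∈ order (-1) 3) ∧
            g * a = b * g) ∧
        g * ⟨0, x.1.1, x.1.2.1, x.1.2.2⟩ = ⟨0, y.1.1, y.1.2.1, y.1.2.2⟩ * g)) := by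
  rw [card_specialPoints_eq_card_unit_classes ht]
  exact card_unit_classes_eq_four_mul_card_normaliser_classes ht h3 h4

/-- **`|L(t)/N(O₆)| ≤ #(Pt(t)/Γ₆) ≤ 4·|L(t)/N(O₆)|` for every `t > 0`**: between one and four points of `X₆` lie below each
normaliser class of special vectors. [cite: KudlaRapoportYang2006, §3.4 (3.4.13) and Remark 3.4.7] [cite: VignerasLNM800, Ch. IV §3 B] -/
theorem card_specialPoints_le_four_mul_card_normaliser_classes {t : ℤ} (ht : 0 < t) :
    Nat.card (Quot (fun x y : {x : ℤ × ℤ × ℤ // x.1 ^ 2 - 3 * x.2.1 ^ 2 - 3 * x.2.2 ^ 2 = t} ↦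
      ∃ g : ℍ[ℚ,((-1 : ℤ) : ℚ),((3 : ℤ) : ℚ)], g ≠ 0 ∧
        (∀ a : ℍ[ℚ,((-1 : ℤ) : ℚ),((3 : ℤ) : ℚ)], (a ∈ order (-1) 3 ∨ a - ⟨1/2, 1/2, 1/2, -1/2⟩ ∈ order (-1) 3) →
          ∃ b : ℍ[ℚ,((-1 : ℤ) : ℚ),((3 : ℤ) : ℚ)], (b ∈ order (-1) 3 ∨ b - ⟨1/2, 1/2, 1/2, -1/2⟩ ∈ order (-1) 3) ∧
            g * a = b * g) ∧
        g * ⟨0, x.1.1, x.1.2.1, x.1.2.2⟩ = ⟨0, y.1.1, y.1.2.1, y.1.2.2⟩ * g)) ≤ Nat.card (Quot (fun p q : {τ : ℂ // 0 < τ.im ∧ ∃ x : ℍ[ℚ,((-1 : ℤ) : ℚ),((3 : ℤ) : ℚ)],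
        x ∈ order (-1) 3 ∧ x.re = 0 ∧ (x * star x).re = t ∧ moebius (rho (-1) 3 (by norm_num) (castQ (-1) 3 x)) τ = τ} ↦
      ∃ v : ℍ[ℚ,((-1 : ℤ) : ℚ),((3 : ℤ) : ℚ)], (v ∈ order (-1) 3 ∨ v - ⟨1/2, 1/2, 1/2, -1/2⟩ ∈ order (-1) 3) ∧
        v * star v = 1 ∧ moebius (rho (-1) 3 (by norm_num) (castQ (-1) 3 v)) p.1 = q.1)) ∧
    Nat.card (Quot (fun p q : {τ : ℂ // 0 < τ.im ∧ ∃ x : ℍ[ℚ,((-1 : ℤ) : ℚ),((3 : ℤ) : ℚ)],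
        x ∈ order (-1) 3 ∧ x.re = 0 ∧ (x * star x).re = t ∧ moebius (rho (-1) 3 (by norm_num) (castQ (-1) 3 x)) τ = τ} ↦
      ∃ v : ℍ[ℚ,((-1 : ℤ) : ℚ),((3 : ℤ) : ℚ)], (v ∈ order (-1) 3 ∨ v - ⟨1/2, 1/2, 1/2, -1/2⟩ ∈ order (-1) 3) ∧
        v * star v = 1 ∧ moebius (rho (-1) 3 (by norm_num) (castQ (-1) 3 v)) p.1 = q.1)) ≤ 4 * Nat.card (Quot (fun x y : {x : ℤ × ℤ × ℤ // x.1 ^ 2 - 3 * x.2.1 ^ 2 - 3 * x.2.2 ^ 2 = t} ↦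
      ∃ g : ℍ[ℚ,((-1 : ℤ) : ℚ),((3 : ℤ) : ℚ)], g ≠ 0 ∧
        (∀ a : ℍ[ℚ,((-1 : ℤ) : ℚ),((3 : ℤ) : ℚ)], (a ∈ order (-1) 3 ∨ a - ⟨1/2, 1/2, 1/2, -1/2⟩ ∈ order (-1) 3) →
          ∃ b : ℍ[ℚ,((-1 : ℤ) : ℚ),((3 : ℤ) : ℚ)], (b ∈ order (-1) 3 ∨ b - ⟨1/2, 1/2, 1/2, -1/2⟩ ∈ order (-1) 3) ∧
            g * a = b * g) ∧
        g * ⟨0, x.1.1, x.1.2.1, x.1.2.2⟩ = ⟨0, y.1.1, y.1.2.1, y.1.2.2⟩ * g)) := by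
  rw [card_specialPoints_eq_card_unit_classes ht]
  exact ⟨card_normaliser_classes_le_card_unit_classes ht, card_unit_classes_le_four_mul_card_normaliser_classes ht⟩

/-- **`Z(19)`: FOUR points on `X₆`, ONE class up to Atkin–Lehner** (`card_specialPoints_table`,
`card_normaliser_classes_nineteen`). [cite: KudlaRapoportYang2006, §3.4 (3.4.13) and Remark 3.4.7] [cite: BayerTravesa2007, §2] -/
theorem card_specialPoints_nineteen :
    Nat.card (Quot (fun p q : {τ : ℂ // 0 < τ.im ∧ ∃ x : ℍ[ℚ,((-1 : ℤ) : ℚ),((3 : ℤ) : ℚ)],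
        x ∈ order (-1) 3 ∧ x.re = 0 ∧ (x * star x).re = ((19 : ℤ) : ℚ) ∧ moebius (rho (-1) 3 (by norm_num) (castQ (-1) 3 x)) τ = τ} ↦
      ∃ v : ℍ[ℚ,((-1 : ℤ) : ℚ),((3 : ℤ) : ℚ)], (v ∈ order (-1) 3 ∨ v - ⟨1/2, 1/2, 1/2, -1/2⟩ ∈ order (-1) 3) ∧
        v * star v = 1 ∧ moebius (rho (-1) 3 (by norm_num) (castQ (-1) 3 v)) p.1 = q.1)) = 4 ∧
    Nat.card (Quot (fun x y : {x : ℤ × ℤ × ℤ // x.1 ^ 2 - 3 * x.2.1 ^ 2 - 3 * x.2.2 ^ 2 = 19} ↦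
      ∃ g : ℍ[ℚ,((-1 : ℤ) : ℚ),((3 : ℤ) : ℚ)], g ≠ 0 ∧
        (∀ a : ℍ[ℚ,((-1 : ℤ) : ℚ),((3 : ℤ) : ℚ)], (a ∈ order (-1) 3 ∨ a - ⟨1/2, 1/2, 1/2, -1/2⟩ ∈ order (-1) 3) →
          ∃ b : ℍ[ℚ,((-1 : ℤ) : ℚ),((3 : ℤ) : ℚ)], (b ∈ order (-1) 3 ∨ b - ⟨1/2, 1/2, 1/2, -1/2⟩ ∈ order (-1) 3) ∧
            g * a = b * g) ∧
        g * ⟨0, x.1.1, x.1.2.1, x.1.2.2⟩ = ⟨0, y.1.1, y.1.2.1, y.1.2.2⟩ * g)) = 1 :=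
  ⟨card_specialPoints_table.2.2.2.2.2.1, card_normaliser_classes_nineteen⟩


end Literature.Geometry.Kaehler.ComplexTorus.QuaternionType
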